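import Summits.AtomisticToContinuum.Crystallization.Theorems.OverbindingBudgetAffineRunCut
import Summits.AtomisticToContinuum.Crystallization.Theorems.OverbindingBudgetAffineCompressedCutInner

/-!
# NODE g85 «RunCut♭» (lens-4) — the competitor leaf made ROBUST TO FINE SOUND FAR MATTER, at zero cost, through the LANDED economical
compressed cut («CompressedCut», `compressedDeepAt`, first class `nn < 17/50` PROVED)

## What and why
The competitor of record `StackSwapGainW` (RunCutA §2, «SW») lets the slipped patch interact with ALL far matter, and its rebate currency
(`#compressedRun + #wildRun + #¬deep + #off + N^{2/3}`) has no term for far sites that are SOUND (deep, in-window) but FINE (own spacing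
`< 17/50`).  Such sites are legal beyond the anchor's `64·nn` ball (and, through gradual scale drift of `3/50`-framed matter, inside it), their density is
bounded only by the window bottom `δ`, and the α-averaged second-order coupling of a slipped site to a partner straight above / below it at distance `d` is
`+(a²/6)·d⁻⁸ > 0` for EVERY slip representative (the mover recedes from an on-axis partner whichever way it slips).  A certified proof of SW verbatim would
therefore have to make the competitor also tap the compression reservoir of that fine matter — absurd to formalise (memo `g85/memo/SW-S3.md` §4).

The economical compressed cut already PRICES every sound site with `nn < 17/50` (first priced class, `nearFieldSlackFirstAt_record`; second class
`nearFieldSlackMinSecond_record`; far field `farFieldControlAt_min`; census `compressedDeepAt_of_siteSlackAt`).  So the competitor may be granted the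
extra rebate `C·#fine` — `StackSwapGainFlatW` («SW♭», WEAKER than SW) — and the census of record `RigidRunExchange` («RX») still follows, by ONE glued
convex combination with the landed census `CompressedDeepAt … (17/50) (17/20) … δ` («KD♭»).  The lossless leaf form of the node
(`interfaceDominance_iff_leaves`) consumes RX, so NOTHING downstream changes: `SW♭ ∧ CompressedRun ∧ WildRun ∧ ThinFault ⇒ InterfaceDominance`, and
with `compressedRun_record` BY NAME, `SW♭ ∧ WildRun ∧ ThinFault ⇒ InterfaceDominance`.

## Contents (all PROVED, 0 sorry)
§1 `fineCount`, `StackSwapGainFlatW` / `TameStackSwapGainFlat` / `StackSwapGainFlat`; SW_W ⇒ SW♭_W.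
§2 the floor step SW♭_W ⇒ `CensusW #rigid (#¬deep + (#compressed + #wild) + #fine)`; `fineCount ≤ pricedCount`; KD♭_W by name; the glue SW♭_W ⇒ RX_W
   (parametric in the run's mechanical literals `ρ₁ η θ₀ s₁ r rh`; KD♭ enters at its own literals).
§3 record: `StackSwapGainFlat → RigidRunExchange`, `… → CompressedRun → WildRun → ThinFault → InterfaceDominance`, RO discharged by name, MR of record.
§4 the WIDE radius `ρ₁ = 24` (memo §5): `CompressedRun → CompressedRunWide` (PROVED, antitone count), `StackSwapGainFlatWide → WildRunWide → ThinFault →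
   InterfaceDominance` and MR of record — the seam if crit-1 rules the far-matter term is to be handled by radius rather than by a density lemma.
-/

namespace Summit.AtomisticToContinuum.Crystallization.Theorems.OverbindingBudgetAffineRunCutFlat

open scoped BigOperators Classical
open Literature.MathematicalPhysics.StatisticalMechanics
open Literature.Geometry.DiscreteGeometry (IsChargeFree nearestDist nearestDist_nonneg nearestDist_le_dist)
open Summit.AtomisticToContinuum.Crystallization.Theorems.OverbindingBudgetMisfitRegistration (Framed Reg DeepReg)
open Summit.AtomisticToContinuum.Crystallization.Theorems.OverbindingBudgetMisfitWindowStatements (InWindow offCount)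
open Summit.AtomisticToContinuum.Crystallization.Theorems.OverbindingBudgetBalancedCensusStatements
open Summit.AtomisticToContinuum.Crystallization.Theorems.OverbindingBudgetAffineLadder
open Summit.AtomisticToContinuum.Crystallization.Theorems.OverbindingBudgetAffineMesoCut
open Summit.AtomisticToContinuum.Crystallization.Theorems.OverbindingBudgetAffinePhaseCut
open Summit.AtomisticToContinuum.Crystallization.Theorems.OverbindingBudgetAffineCushionCut
open Summit.AtomisticToContinuum.Crystallization.Theorems.OverbindingBudgetAffineTwinCut
open Summit.AtomisticToContinuum.Crystallization.Theorems.OverbindingBudgetAffineRunCut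
open Summit.AtomisticToContinuum.Crystallization.Theorems.OverbindingBudgetAffineCompressedCut
open Summit.AtomisticToContinuum.Crystallization.Theorems.OverbindingBudgetAffineCompressedCutInner (nearFieldSlackMinSecond_record)

variable {N : ℕ}

/-! ## §1  The flat competitor -/

/-- `#fine`: the SOUND (`(ρ, ε)`-deeply registered, in the window `[σ₁, 2]`) sites FINER than `s₀` — exactly the first priced class of «CompressedCut». -/
noncomputable def fineCount (ρ ε g s₀ σ₁ : ℝ) (y : Fin N → EuclideanSpace ℝ (Fin 3)) : ℕ :=
  Nat.card {i : Fin N // Sound ρ ε g σ₁ y i ∧ nearestDist y i < s₀}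

/-- **`StackSwapGainFlatW … s₀ … σ₁ σ₂`** («SW♭_W») — `StackSwapGainW` VERBATIM with ONE extra rebate `C·#fine(s₀, σ₁)`: an injective competitor moving
only `(r, ε)`-deep, C-framed, in-window sites by `≤` their nearest-neighbour distance, with
`𝓔(y′) + c·#rigidRun ≤ 𝓔(y) + C·(#compressedRun + #wildRun) + C·#fine + C·#¬deep + C·#off + C·N^{2/3}`. [this file · kind: statement (competitor) ·
WEAKER than SW · sufficient for RX (§2)] -/
def StackSwapGainFlatW (ρ ρ₁ η θ₀ s₀ s₁ ε g r rh σ₁ σ₂ : ℝ) : Prop :=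
  ∃ c C : ℝ, 0 < c ∧ ∀ (N : ℕ) (y : Fin N → EuclideanSpace ℝ (Fin 3)), Function.Injective y →
    ∃ y' : Fin N → EuclideanSpace ℝ (Fin 3), Function.Injective y' ∧
      (∀ i : Fin N, y' i ≠ y i → (DeepReg r ε g y i ∧ CFramed ε g y i ∧ InWindow σ₁ σ₂ y i) ∧ dist (y' i) (y i) ≤ nearestDist y i) ∧
      interactionEnergy lennardJones y' + c * (rigidRunCount ρ ρ₁ η θ₀ s₁ ε g r rh y : ℝ)
        ≤ interactionEnergy lennardJones y
          + C * ((compressedRunCount ρ ρ₁ η θ₀ s₁ ε g r rh y + wildRunCount ρ ρ₁ η θ₀ ε g r rh y : ℕ) : ℝ)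
          + C * (fineCount ρ ε g s₀ σ₁ y : ℝ)
          + C * (notDeepCount ρ ε g y : ℝ) + C * (offCount σ₁ σ₂ y : ℝ) + C * (N : ℝ) ^ (2 / 3 : ℝ)

/-- SW♭ (tame): every window `[δ, 2]`. -/
def TameStackSwapGainFlat (ρ ρ₁ η θ₀ s₀ s₁ ε g r rh : ℝ) : Prop :=
  ∀ δ : ℝ, 0 < δ → δ ≤ 2 → StackSwapGainFlatW ρ ρ₁ η θ₀ s₀ s₁ ε g r rh δ 2

/-- **`StackSwapGainFlat`** («SW♭») — the flat competitor at the literals of record, fine threshold `s₀ = 17/50` (the economical cut's). [this file ·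
kind: statement (competitor) · WEAKER than `StackSwapGain` · THE RECOMMENDED COMPETITOR LEAF] -/
def StackSwapGainFlat : Prop :=
  TameStackSwapGainFlat 64 12 (1 / 10 ^ 4) (1 / 1000) (17 / 50) (17 / 20) (3 / 50) (1 / 450) 12 2

/-- **SW_W ⇒ SW♭_W** (the same competitor; the extra rebate is non-negative). [this file] -/
theorem stackSwapGainFlatW_of_stackSwapGainW {ρ ρ₁ η θ₀ s₁ ε g r rh σ₁ σ₂ : ℝ} (s₀ : ℝ)
    (h : StackSwapGainW ρ ρ₁ η θ₀ s₁ ε g r rh σ₁ σ₂) : StackSwapGainFlatW ρ ρ₁ η θ₀ s₀ s₁ ε g r rh σ₁ σ₂ := by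
  obtain ⟨c, C, hc, h⟩ := h
  refine ⟨c, max C 0, hc, fun N y hy => ?_⟩
  obtain ⟨y', hy', hmv, H⟩ := h N y hy
  refine ⟨y', hy', hmv, ?_⟩
  have hCle : C ≤ max C 0 := le_max_left _ _
  have hC0 : 0 ≤ max C 0 := le_max_right _ _
  have nX : (0 : ℝ) ≤ ((compressedRunCount ρ ρ₁ η θ₀ s₁ ε g r rh y + wildRunCount ρ ρ₁ η θ₀ ε g r rh y : ℕ) : ℝ) := Nat.cast_nonneg _
  have nF : (0 : ℝ) ≤ (fineCount ρ ε g s₀ σ₁ y : ℝ) := Nat.cast_nonneg _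
  have nD : (0 : ℝ) ≤ notDeepCount ρ ε g y := Nat.cast_nonneg _
  have nO : (0 : ℝ) ≤ offCount σ₁ σ₂ y := Nat.cast_nonneg _
  have nS : (0 : ℝ) ≤ (N : ℝ) ^ (2 / 3 : ℝ) := Real.rpow_nonneg (Nat.cast_nonneg _) _
  have m1 : C * ((compressedRunCount ρ ρ₁ η θ₀ s₁ ε g r rh y + wildRunCount ρ ρ₁ η θ₀ ε g r rh y : ℕ) : ℝ)
      ≤ max C 0 * ((compressedRunCount ρ ρ₁ η θ₀ s₁ ε g r rh y + wildRunCount ρ ρ₁ η θ₀ ε g r rh y : ℕ) : ℝ) :=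
    mul_le_mul_of_nonneg_right hCle nX
  have m2 : C * (notDeepCount ρ ε g y : ℝ) ≤ max C 0 * (notDeepCount ρ ε g y : ℝ) := mul_le_mul_of_nonneg_right hCle nD
  have m3 : C * (offCount σ₁ σ₂ y : ℝ) ≤ max C 0 * (offCount σ₁ σ₂ y : ℝ) := mul_le_mul_of_nonneg_right hCle nO
  have m4 : C * (N : ℝ) ^ (2 / 3 : ℝ) ≤ max C 0 * (N : ℝ) ^ (2 / 3 : ℝ) := mul_le_mul_of_nonneg_right hCle nS
  have m5 : 0 ≤ max C 0 * (fineCount ρ ε g s₀ σ₁ y : ℝ) := mul_nonneg hC0 nF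
  linarith [H, m1, m2, m3, m4, m5]

/-- `StackSwapGain → StackSwapGainFlat` (SW♭ is WEAKER than the competitor of record). [this file] -/
theorem stackSwapGainFlat_of_stackSwapGain (h : StackSwapGain) : StackSwapGainFlat :=
  fun δ hδ hδ2 => stackSwapGainFlatW_of_stackSwapGainW (17 / 50) (h δ hδ hδ2)

/-! ## §2  SW♭ ⇒ RX: the floor step and ONE glue with the landed economical census -/

/-- **THE FLOOR STEP: SW♭_W ⇒ `CensusW #rigidRun (#¬deep + (#compressedRun + #wildRun) + #fine)`** — the free bulk floor `N e⋆ ≤ 𝓔(y′)`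
(`floor_le` BY NAME) spent on the competitor. [this file] -/
theorem censusW_of_stackSwapGainFlatW {ρ ρ₁ η θ₀ s₀ s₁ ε g r rh σ₁ σ₂ : ℝ} (hT : StackSwapGainFlatW ρ ρ₁ η θ₀ s₀ s₁ ε g r rh σ₁ σ₂) :
    CensusW (fun y => rigidRunCount ρ ρ₁ η θ₀ s₁ ε g r rh y)
      (fun y => notDeepCount ρ ε g y + (compressedRunCount ρ ρ₁ η θ₀ s₁ ε g r rh y + wildRunCount ρ ρ₁ η θ₀ ε g r rh y)
        + fineCount ρ ε g s₀ σ₁ y) σ₁ σ₂ := by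
  obtain ⟨c, C, hc, h⟩ := hT
  refine ⟨c, max C 0, hc, fun N y hy => ⟨e0, norm_e0, ?_⟩⟩
  obtain ⟨y', hy', -, H⟩ := h N y hy
  have hfl := floor_le hy'
  have hCle : C ≤ max C 0 := le_max_left _ _
  have hC0 : 0 ≤ max C 0 := le_max_right _ _
  have nX : (0 : ℝ) ≤ ((compressedRunCount ρ ρ₁ η θ₀ s₁ ε g r rh y + wildRunCount ρ ρ₁ η θ₀ ε g r rh y : ℕ) : ℝ) := Nat.cast_nonneg _
  have nF : (0 : ℝ) ≤ (fineCount ρ ε g s₀ σ₁ y : ℝ) := Nat.cast_nonneg _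
  have nD : (0 : ℝ) ≤ notDeepCount ρ ε g y := Nat.cast_nonneg _
  have nO : (0 : ℝ) ≤ offCount σ₁ σ₂ y := Nat.cast_nonneg _
  have nS : (0 : ℝ) ≤ (N : ℝ) ^ (2 / 3 : ℝ) := Real.rpow_nonneg (Nat.cast_nonneg _) _
  have g2 : 0 ≤ dilGain y + shGain e0 y := add_nonneg (dilGain_nonneg y) (shGain_nonneg _ y)
  have m1 : C * ((compressedRunCount ρ ρ₁ η θ₀ s₁ ε g r rh y + wildRunCount ρ ρ₁ η θ₀ ε g r rh y : ℕ) : ℝ)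
      ≤ max C 0 * ((compressedRunCount ρ ρ₁ η θ₀ s₁ ε g r rh y + wildRunCount ρ ρ₁ η θ₀ ε g r rh y : ℕ) : ℝ) :=
    mul_le_mul_of_nonneg_right hCle nX
  have m2 : C * (notDeepCount ρ ε g y : ℝ) ≤ max C 0 * (notDeepCount ρ ε g y : ℝ) := mul_le_mul_of_nonneg_right hCle nD
  have m3 : C * (offCount σ₁ σ₂ y : ℝ) ≤ max C 0 * (offCount σ₁ σ₂ y : ℝ) := mul_le_mul_of_nonneg_right hCle nO
  have m4 : C * (N : ℝ) ^ (2 / 3 : ℝ) ≤ max C 0 * (N : ℝ) ^ (2 / 3 : ℝ) := mul_le_mul_of_nonneg_right hCle nS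
  have m5 : 0 ≤ max C 0 * (dilGain y + shGain e0 y) := mul_nonneg hC0 g2
  have m6 : C * (fineCount ρ ε g s₀ σ₁ y : ℝ) ≤ max C 0 * (fineCount ρ ε g s₀ σ₁ y : ℝ) := mul_le_mul_of_nonneg_right hCle nF
  push_cast at H m1 ⊢
  nlinarith [H, hfl, m1, m2, m3, m4, m5, m6]

/-- `#fine ≤ #priced` (the fine sound sites ARE the first priced class of «CompressedCut», whatever `ρ₁ η θ₀ s₁`). [this file] -/
theorem fineCount_le_pricedCount {ρ ρ₁ η θ₀ s₀ s₁ ε g δ : ℝ} (y : Fin N → EuclideanSpace ℝ (Fin 3)) :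
    fineCount ρ ε g s₀ δ y ≤ pricedCount ρ ρ₁ η θ₀ s₀ s₁ ε g δ y := by
  simp only [fineCount, pricedCount, Nat.card_eq_fintype_card, Fintype.card_subtype]
  apply Finset.card_le_card
  intro j hj
  rw [Finset.mem_filter] at hj ⊢
  exact ⟨hj.1, hj.2.1, Or.inl hj.2.2⟩

/-- **KD♭_W BY NAME**: the economical two-class census `CompressedDeepAt 64 12 10⁻⁴ 10⁻³ (17/50) (17/20) (3/50) (1/450) δ` holds on every window —
first class `nearFieldSlackFirstAt_record`, second class `nearFieldSlackMinSecond_record`, far field `farFieldControlAt_min`, `PS → KD`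
`compressedDeepAt_of_siteSlackAt` (all landed, «CompressedCut» g79–g83). [this file; bookkeeping on landed theorems] -/
theorem compressedDeepAt_min {δ : ℝ} (hδ : 0 < δ) (hδ2 : δ ≤ 2) :
    CompressedDeepAt 64 12 (1 / 10 ^ 4) (1 / 1000) (17 / 50) (17 / 20) (3 / 50) (1 / 450) δ :=
  compressedDeepAt_of_siteSlackAt hδ
    (compressedSiteSlackAt_of_near_far (nearFieldSlackMin_of_second nearFieldSlackMinSecond_record δ hδ hδ2) (farFieldControlAt_min hδ))

/-- **THE GLUE: SW♭_W ∧ KD♭_W ⇒ RX_W** — the fine currency is bought back by ONE glued convex combination (`censusW_glue` with `D₁ = D + #fine`,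
`#fine ≤ #priced`).  Parametric in the run's mechanical literals `(ρ₁, η, θ₀, s₁, r, rh)`; KD♭ enters at its own. [this file] -/
theorem balancedRigidRunExchangeGapW_of_stackSwapGainFlatW {ρ₁ η θ₀ s₁ r rh δ : ℝ} (hδ : 0 < δ) (hδ2 : δ ≤ 2)
    (hT : StackSwapGainFlatW 64 ρ₁ η θ₀ (17 / 50) s₁ (3 / 50) (1 / 450) r rh δ 2) :
    BalancedRigidRunExchangeGapW 64 ρ₁ η θ₀ s₁ (3 / 50) (1 / 450) r rh δ 2 := by
  have hK : CensusW (fun y => pricedCount 64 12 (1 / 10 ^ 4) (1 / 1000) (17 / 50) (17 / 20) (3 / 50) (1 / 450) δ y)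
      (fun y => notDeepCount 64 (3 / 50) (1 / 450) y
        + (compressedRunCount 64 ρ₁ η θ₀ s₁ (3 / 50) (1 / 450) r rh y + wildRunCount 64 ρ₁ η θ₀ (3 / 50) (1 / 450) r rh y)) δ 2 :=
    censusW_mono (fun _ => le_rfl) (fun _ => Nat.le_add_right _ _) (compressedDeepAt_min hδ hδ2)
  exact balancedRigidRunExchangeGapW_iff_censusW.2 <|
    censusW_glue (fun _ => Nat.le_add_right _ _) (fun y => Nat.add_le_add_left (fineCount_le_pricedCount y) _)
      (censusW_of_stackSwapGainFlatW hT) hK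

/-! ## §3  The record through SW♭ -/

/-- **SW♭ ⇒ RigidRunExchange** — the flat competitor suffices for the on-record surgery leaf. [this file] -/
theorem rigidRunExchange_of_stackSwapGainFlat (h : StackSwapGainFlat) : RigidRunExchange :=
  fun δ hδ hδ2 => balancedRigidRunExchangeGapW_of_stackSwapGainFlatW hδ hδ2 (h δ hδ hδ2)

/-- **THE COMPETITOR SEAM, FLAT FORM: StackSwapGainFlat ∧ CompressedRun ∧ WildRun ∧ ThinFault ⇒ InterfaceDominance** (through the lossless leaf form
`interfaceDominance_iff_leaves`). [this file] -/
theorem interfaceDominance_of_swapFlat_thinFault (hT : StackSwapGainFlat) (hO : CompressedRun) (hX : WildRun) (hF : ThinFault) :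
    InterfaceDominance :=
  interfaceDominance_iff_leaves.2 ⟨rigidRunExchange_of_stackSwapGainFlat hT, hO, hX, hF⟩

/-- **With RO discharged BY NAME (`compressedRun_record`): StackSwapGainFlat ∧ WildRun ∧ ThinFault ⇒ InterfaceDominance.** [this file] -/
theorem interfaceDominance_of_swapFlat_wild_thinFault (hT : StackSwapGainFlat) (hX : WildRun) (hF : ThinFault) : InterfaceDominance :=
  interfaceDominance_of_swapFlat_thinFault hT OverbindingBudgetAffineCompressedCutInner.compressedRun_record hX hF

/-- **MR of record from `QH ∧ RoughCubic ∧ StackSwapGainFlat ∧ WildRun ∧ ThinFault`** (RO by name). [this file] -/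
theorem affMid_record_of_swapFlat_thinFault (hQH : TameBalancedHexRoughGap 64 12 (1 / 10 ^ 5) (1 / 25) (3 / 50) (1 / 450) 12) (hQ : RoughCubic)
    (hT : StackSwapGainFlat) (hX : WildRun) (hF : ThinFault) :
    TameBalancedAffMidGap 64 12 (1 / 10 ^ 5) (1 / 25) (3 / 50) (1 / 450) :=
  affMid_record_of_leaves hQH hQ (rigidRunExchange_of_stackSwapGainFlat hT) OverbindingBudgetAffineCompressedCutInner.compressedRun_record hX hF

/-! ## §4  The WIDE mechanical radius `ρ₁ = 24` (memo `g85/memo/SW-S3.md` §5)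

With the affine-depth radius of the run trichotomy doubled, every partner within `22·nn` of a moved site is `(10⁻⁴, 10⁻³)`-affinely charted and the
whole far field beyond is either CURRENCY (charged to itself) or COARSE sound matter (`nn ≥ 17/50`, crude cone bound `≤ 2.8·a²·(22a)⁻⁵` per moved
site, `< 4 %` of the gain even at `a = 2`) — NO structural density lemma is needed.  Cost: `CompressedRun` is ANTITONE in `ρ₁` (landed RO ⇒ RO₂₄, below,
PROVED), `WildRun₂₄` is the same mechanism with the constant `× 8`; `InterfaceDominance`, `RunInterior`, `ThinFault` do not mention `ρ₁` at all. -/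

/-- Radius monotonicity of affine depth. [this file] -/
theorem affDeepReg_of_radius_le {ρ₁ ρ₁' η θ₀ g : ℝ} (h : ρ₁ ≤ ρ₁') {y : Fin N → EuclideanSpace ℝ (Fin 3)} {i : Fin N}
    (hA : AffDeepReg ρ₁' η θ₀ g y i) : AffDeepReg ρ₁ η θ₀ g y i :=
  fun i' hi' => hA i' (hi'.trans (mul_le_mul_of_nonneg_right h (nearestDist_nonneg y i)))

/-- `#compressedRun` is ANTITONE in the affine-depth radius `ρ₁`. [this file] -/
theorem compressedRunCount_anti_radius {ρ ρ₁ ρ₁' η θ₀ s₁ ε g r rh : ℝ} (h : ρ₁ ≤ ρ₁') (y : Fin N → EuclideanSpace ℝ (Fin 3)) :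
    compressedRunCount ρ ρ₁' η θ₀ s₁ ε g r rh y ≤ compressedRunCount ρ ρ₁ η θ₀ s₁ ε g r rh y := by
  simp only [compressedRunCount, Nat.card_eq_fintype_card, Fintype.card_subtype]
  apply Finset.card_le_card
  intro j hj
  rw [Finset.mem_filter] at hj ⊢
  exact ⟨hj.1, hj.2.1, affDeepReg_of_radius_le h hj.2.2.1, hj.2.2.2⟩

/-- CompressedRun_W is MONOTONE in `ρ₁` (fewer priced sites). [this file] -/
theorem balancedCompressedRunGapW_of_radius_le {ρ ρ₁ ρ₁' η θ₀ s₁ ε g r rh σ₁ σ₂ : ℝ} (h : ρ₁ ≤ ρ₁')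
    (hO : BalancedCompressedRunGapW ρ ρ₁ η θ₀ s₁ ε g r rh σ₁ σ₂) : BalancedCompressedRunGapW ρ ρ₁' η θ₀ s₁ ε g r rh σ₁ σ₂ :=
  balancedCompressedRunGapW_iff_censusW.2 <|
    censusW_mono (fun y => compressedRunCount_anti_radius h y) (fun _ => le_rfl) (balancedCompressedRunGapW_iff_censusW.1 hO)

/-- **`CompressedRunWide`** «RO₂₄». [this file · kind: statement · a COROLLARY of the landed `CompressedRun`] -/
def CompressedRunWide : Prop :=
  TameBalancedCompressedRunGap 64 24 (1 / 10 ^ 4) (1 / 1000) (17 / 20) (3 / 50) (1 / 450) 12 2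

/-- **`WildRunWide`** «RW₂₄» — wild := NOT `(24, 10⁻⁴, 10⁻³)`-affinely deep. [this file · kind: statement · WEAKER than HI · IDEA-NEEDED (as RW)] -/
def WildRunWide : Prop :=
  TameBalancedWildRunGap 64 24 (1 / 10 ^ 4) (1 / 1000) (3 / 50) (1 / 450) 12 2

/-- **`StackSwapGainFlatWide`** «SW♭₂₄» — the flat competitor paying only for `(24, 10⁻⁴, 10⁻³)`-affinely deep uncompressed run sites. [this file ·
kind: statement (competitor)] -/
def StackSwapGainFlatWide : Prop :=
  TameStackSwapGainFlat 64 24 (1 / 10 ^ 4) (1 / 1000) (17 / 50) (17 / 20) (3 / 50) (1 / 450) 12 2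

/-- `CompressedRun → CompressedRunWide`. [this file] -/
theorem compressedRunWide_of_compressedRun (h : CompressedRun) : CompressedRunWide :=
  fun δ hδ hδ2 => balancedCompressedRunGapW_of_radius_le (by norm_num) (h δ hδ hδ2)

/-- **RO₂₄ HOLDS** (from the landed `compressedRun_record`). [this file] -/
theorem compressedRunWide_record : CompressedRunWide :=
  compressedRunWide_of_compressedRun OverbindingBudgetAffineCompressedCutInner.compressedRun_record

/-- One window, any mechanical literals: **SW♭_W ∧ RO_W ∧ RW_W ⇒ RunInterior_W** (RunInterior does not mention `ρ₁`). [this file] -/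
theorem balancedRunInteriorGapW_of_swapFlatW {ρ₁ η θ₀ s₁ r rh δ : ℝ} (hδ : 0 < δ) (hδ2 : δ ≤ 2)
    (hT : StackSwapGainFlatW 64 ρ₁ η θ₀ (17 / 50) s₁ (3 / 50) (1 / 450) r rh δ 2)
    (hO : BalancedCompressedRunGapW 64 ρ₁ η θ₀ s₁ (3 / 50) (1 / 450) r rh δ 2) (hX : BalancedWildRunGapW 64 ρ₁ η θ₀ (3 / 50) (1 / 450) r rh δ 2) :
    BalancedRunInteriorGapW 64 (3 / 50) (1 / 450) r rh δ 2 :=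
  balancedRunInteriorGapW_of_rigid_compressed_wild
    (balancedRigidRunGapW_of_exchange_compressed_wild (balancedRigidRunExchangeGapW_of_stackSwapGainFlatW hδ hδ2 hT) hO hX) hO hX

/-- **SW♭₂₄ ∧ RO₂₄ ∧ RW₂₄ ⇒ RunInterior.** [this file] -/
theorem runInterior_of_swapFlatWide (hT : StackSwapGainFlatWide) (hO : CompressedRunWide) (hX : WildRunWide) : RunInterior :=
  fun δ hδ hδ2 => balancedRunInteriorGapW_of_swapFlatW hδ hδ2 (hT δ hδ hδ2) (hO δ hδ hδ2) (hX δ hδ hδ2)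

/-- **THE WIDE SEAM: StackSwapGainFlatWide ∧ WildRunWide ∧ ThinFault ⇒ InterfaceDominance** (RO₂₄ by name). [this file] -/
theorem interfaceDominance_of_swapFlatWide_thinFault (hT : StackSwapGainFlatWide) (hX : WildRunWide) (hF : ThinFault) : InterfaceDominance :=
  interfaceDominance_iff_runInterior_thinFault.2 ⟨runInterior_of_swapFlatWide hT compressedRunWide_record hX, hF⟩

/-- **MR of record from `QH ∧ RoughCubic ∧ StackSwapGainFlatWide ∧ WildRunWide ∧ ThinFault`.** [this file] -/
theorem affMid_record_of_swapFlatWide_thinFault (hQH : TameBalancedHexRoughGap 64 12 (1 / 10 ^ 5) (1 / 25) (3 / 50) (1 / 450) 12)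
    (hQ : RoughCubic) (hT : StackSwapGainFlatWide) (hX : WildRunWide) (hF : ThinFault) :
    TameBalancedAffMidGap 64 12 (1 / 10 ^ 5) (1 / 25) (3 / 50) (1 / 450) :=
  affMid_record_of_roughCut hQH hQ (interfaceDominance_of_swapFlatWide_thinFault hT hX hF)

end Summit.AtomisticToContinuum.Crystallization.Theorems.OverbindingBudgetAffineRunCutFlat
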